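import Summits.HodgeConjecture.HodgeCM.PerL34.FockUniqueness_1

/-! PORT of `HodgeCM/PerL34/FockUniqueness.lean` (HodgeCMPerL run 82) — part 2: continuation of `Summits.HodgeConjecture.HodgeCM.PerL34.FockUniqueness_1` (split at a top-level declaration boundary by port_pkg.py; scope re-opened below; declarations unchanged). -/

-- port_pkg: scope re-opened for this part (file-level context, then the namespace/section stack open at the cut)
set_option autoImplicit false
namespace HodgeCM
namespace PerL34
namespace Fock
open scoped BigOperators
attribute [local instance 100] LieRing.ofAssociativeRing
namespace Uniq
section Words
variable {ι : Type*} [Fintype ι] [DecidableEq ι]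
variable {M : Type*} [AddCommGroup M] [Module ℂ M] [LieRingModule (Matrix ι ι ℂ) M]
  [LieModule ℂ (Matrix ι ι ℂ) M]
variable (a b c : ι)
variable {a b c}
/-- hence the words of positive degree lie in the `H`-eigenspaces of eigenvalue `≠ wt a - wt c` … -/
theorem span_wordsPos_le (hab : a ≠ b) (hbc : b ≠ c) (hac : a ≠ c) {wt : ι → ℂ} {v : M}
    (hv : IsExtremalVec a b c wt v) :
    Submodule.span ℂ (wordsPos a b c v) ≤
      ⨆ (μ : ℂ) (_ : μ ≠ wt a - wt c), (LieModule.toEnd ℂ (Matrix ι ι ℂ) M (H a c)).eigenspace μ := by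
  rw [Submodule.span_le]
  rintro w ⟨d, hd⟩
  have hne : wt a - wt c + ((d + 1 : ℕ) : ℂ) ≠ wt a - wt c := by
    rw [ne_eq, add_eq_left, Nat.cast_eq_zero]
    exact Nat.succ_ne_zero d
  have hw : w ∈ (LieModule.toEnd ℂ (Matrix ι ι ℂ) M (H a c)).eigenspace (wt a - wt c + ((d + 1 : ℕ) : ℂ)) := by
    rw [Module.End.mem_eigenspace_iff, LieModule.toEnd_apply_apply]
    exact lie_H_word hab hbc hac hv hd
  exact le_iSup₂ (f := fun μ (_ : μ ≠ wt a - wt c) => (LieModule.toEnd ℂ (Matrix ι ι ℂ) M (H a c)).eigenspace μ)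
    _ hne hw

/-- … so **a vector of the generated module with the `H`-eigenvalue of `v` is a multiple of `v`**. -/
theorem eq_smul_of_mem_wordSpan (hab : a ≠ b) (hbc : b ≠ c) (hac : a ≠ c) {wt : ι → ℂ} {v : M}
    (hv : IsExtremalVec a b c wt v) {p : M} (hp : p ∈ wordSpan a b c v)
    (hpH : ⁅H a c, p⁆ = (wt a - wt c) • p) : ∃ t : ℂ, p = t • v := by
  rw [wordSpan, words_eq_insert, Submodule.mem_span_insert] at hp
  obtain ⟨t, s, hs, rfl⟩ := hp
  refine ⟨t, ?_⟩
  set T := LieModule.toEnd ℂ (Matrix ι ι ℂ) M (H a c) with hT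
  -- `s = p - t • v` is an `H`-eigenvector for `wt a - wt c` lying in the other eigenspaces
  have hs1 : s ∈ T.eigenspace (wt a - wt c) := by
    rw [Module.End.mem_eigenspace_iff, LieModule.toEnd_apply_apply]
    have hv1 : ⁅H a c, v⁆ = (wt a - wt c) • v := by
      have := lie_H_word hab hbc hac hv (IsWord.base (a := a) (b := b) (c := c) (v := v))
      rwa [Nat.cast_zero, add_zero] at this
    have h2 : ⁅H a c, t • v + s⁆ = (wt a - wt c) • (t • v + s) := hpH
    rw [lie_add, lie_smul, hv1, smul_add, smul_comm] at h2
    exact add_left_cancel h2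
  have hs2 : s ∈ ⨆ (μ : ℂ) (_ : μ ≠ wt a - wt c), T.eigenspace μ := span_wordsPos_le hab hbc hac hv hs
  have hdis := (Module.End.eigenspaces_iSupIndep T) (wt a - wt c)
  have hs0 : s = 0 := (Submodule.disjoint_def.mp hdis) s hs1 hs2
  rw [hs0, add_zero]

/-- **multiplicity one of the extremal line**: in an irreducible module generated by the extremal vector `v` of
weight `wt`, every `H`-eigenvector of eigenvalue `wt a - wt c` (in particular every weight vector of weight `wt`) is
a multiple of `v`. -/
theorem exists_eq_smul_of_lie_H [LieModule.IsIrreducible ℂ (Matrix ι ι ℂ) M] (hab : a ≠ b) (hbc : b ≠ c)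
    (hac : a ≠ c) (huniv : ∀ i, i = a ∨ i = b ∨ i = c) {wt : ι → ℂ} {v : M} (hv : IsExtremalVec a b c wt v)
    (hv0 : v ≠ 0) {p : M} (hpH : ⁅H a c, p⁆ = (wt a - wt c) • p) : ∃ t : ℂ, p = t • v :=
  eq_smul_of_mem_wordSpan hab hbc hac hv (by rw [wordSpan_eq_top hab hbc hac huniv hv hv0]; exact Submodule.mem_top)
    hpH

end Words

/-! ## 3. Uniqueness of the irreducible module with a given extremal weight -/

section Uniqueness

variable {ι : Type*} [Fintype ι] [DecidableEq ι] {a b c : ι}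
variable {M : Type*} [AddCommGroup M] [Module ℂ M] [LieRingModule (Matrix ι ι ℂ) M]
  [LieModule ℂ (Matrix ι ι ℂ) M]
variable {N : Type*} [AddCommGroup N] [Module ℂ N] [LieRingModule (Matrix ι ι ℂ) N]
  [LieModule ℂ (Matrix ι ι ℂ) N]

attribute [local instance] prodLieRingModule prodLieModule

omit [LieModule ℂ (Matrix ι ι ℂ) M] [LieModule ℂ (Matrix ι ι ℂ) N] in
/-- (Ported verbatim from the HodgeCMPerL package; no docstring in the source.) -/
theorem isExtremalVec_prod {wt : ι → ℂ} {x : M} {y : N} (hx : IsExtremalVec a b c wt x)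
    (hy : IsExtremalVec a b c wt y) : IsExtremalVec a b c wt ((x, y) : M × N) where
  diag i := Prod.ext (by rw [prod_lie_fst, hx.diag, Prod.smul_fst]) (by rw [prod_lie_snd, hy.diag, Prod.smul_snd])
  kill_ba := Prod.ext (by rw [prod_lie_fst, hx.kill_ba, Prod.fst_zero]) (by rw [prod_lie_snd, hy.kill_ba, Prod.snd_zero])
  kill_ca := Prod.ext (by rw [prod_lie_fst, hx.kill_ca, Prod.fst_zero]) (by rw [prod_lie_snd, hy.kill_ca, Prod.snd_zero])
  kill_cb := Prod.ext (by rw [prod_lie_fst, hx.kill_cb, Prod.fst_zero]) (by rw [prod_lie_snd, hy.kill_cb, Prod.snd_zero])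

/-- **Uniqueness of the irreducible module of a given extremal (lowest / highest) weight.**  Two irreducible Lie
modules over `𝔤𝔩(ι, ℂ)` (`ι = {a, b, c}`) having nonzero extremal vectors of the same weight for the same ordered
triple are isomorphic Lie modules. -/
theorem nonempty_equiv_of_isExtremalVec [LieModule.IsIrreducible ℂ (Matrix ι ι ℂ) M]
    [LieModule.IsIrreducible ℂ (Matrix ι ι ℂ) N] (hab : a ≠ b) (hbc : b ≠ c) (hac : a ≠ c)
    (huniv : ∀ i, i = a ∨ i = b ∨ i = c) {wt : ι → ℂ} {x : M} {y : N} (hx : IsExtremalVec a b c wt x)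
    (hy : IsExtremalVec a b c wt y) (hx0 : x ≠ 0) (hy0 : y ≠ 0) :
    Nonempty (M ≃ₗ⁅ℂ, Matrix ι ι ℂ⁆ N) := by
  have hz : IsExtremalVec a b c wt ((x, y) : M × N) := isExtremalVec_prod hx hy
  let S : LieSubmodule ℂ (Matrix ι ι ℂ) (M × N) := wordSubmodule hab hbc hac huniv hz
  have hzS : ((x, y) : M × N) ∈ S := self_mem_wordSpan a b c _
  -- `H` acts on `(x, 0)` and `(0, y)` by `wt a - wt c`
  have hHx : ⁅H a c, x⁆ = (wt a - wt c) • x := by rw [sub_lie, hx.diag, hx.diag, sub_smul]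
  have hHy : ⁅H a c, y⁆ = (wt a - wt c) • y := by rw [sub_lie, hy.diag, hy.diag, sub_smul]
  -- neither `(x, 0)` nor `(0, y)` lies in `S`
  have hx_not : ((x, 0) : M × N) ∉ S := by
    intro hmem
    obtain ⟨t, ht⟩ := eq_smul_of_mem_wordSpan hab hbc hac hz hmem
      (Prod.ext (by rw [prod_lie_fst, hHx, Prod.smul_fst]) (by rw [prod_lie_snd, lie_zero, Prod.smul_snd, smul_zero]))
    have h2 : (0 : N) = t • y := by simpa using congrArg Prod.snd ht
    have ht0 : t = 0 := by
      rcases smul_eq_zero.mp h2.symm with h | h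
      · exact h
      · exact absurd h hy0
    have h1 : x = t • x := by simpa using congrArg Prod.fst ht
    rw [ht0, zero_smul] at h1
    exact hx0 h1
  have hy_not : ((0, y) : M × N) ∉ S := by
    intro hmem
    obtain ⟨t, ht⟩ := eq_smul_of_mem_wordSpan hab hbc hac hz hmem
      (Prod.ext (by rw [prod_lie_fst, lie_zero, Prod.smul_fst, smul_zero]) (by rw [prod_lie_snd, hHy, Prod.smul_snd]))
    have h1 : (0 : M) = t • x := by simpa using congrArg Prod.fst ht
    have ht0 : t = 0 := by
      rcases smul_eq_zero.mp h1.symm with h | h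
      · exact h
      · exact absurd h hx0
    have h2 : y = t • y := by simpa using congrArg Prod.snd ht
    rw [ht0, zero_smul] at h2
    exact hy0 h2
  -- the two projections restricted to `S`
  let f₁ : S →ₗ⁅ℂ, Matrix ι ι ℂ⁆ M := (fstHom (R := ℂ) (L := Matrix ι ι ℂ)).comp S.incl
  let f₂ : S →ₗ⁅ℂ, Matrix ι ι ℂ⁆ N := (sndHom (R := ℂ) (L := Matrix ι ι ℂ)).comp S.incl
  -- injectivity: the kernel of `f₂` is `S ∩ (M × 0)`, a Lie submodule of `M` not containing `x`, hence `⊥`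
  have hinj₂ : Function.Injective f₂ := by
    let K : LieSubmodule ℂ (Matrix ι ι ℂ) M := S.comap (inlHom (R := ℂ) (L := Matrix ι ι ℂ))
    have hK : K = ⊥ := by
      rcases IsSimpleOrder.eq_bot_or_eq_top K with h | h
      · exact h
      · exfalso
        have : x ∈ K := by rw [h]; exact LieSubmodule.mem_top x
        exact hx_not ((LieSubmodule.mem_comap).mp this)
    rw [← LieModuleHom.ker_eq_bot, LieSubmodule.eq_bot_iff]
    intro s hs
    rw [LieModuleHom.mem_ker] at hs
    have hs' : (s : M × N).2 = 0 := hs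
    have hmem : (s : M × N).1 ∈ K := by
      rw [LieSubmodule.mem_comap, inlHom_apply]
      have : ((s : M × N).1, (0 : N)) = (s : M × N) := Prod.ext rfl hs'.symm
      rw [this]; exact s.2
    rw [hK] at hmem
    have h1 : (s : M × N).1 = 0 := (LieSubmodule.mem_bot _).mp hmem
    exact Subtype.ext (Prod.ext h1 hs')
  have hinj₁ : Function.Injective f₁ := by
    let K : LieSubmodule ℂ (Matrix ι ι ℂ) N := S.comap (inrHom (R := ℂ) (L := Matrix ι ι ℂ))
    have hK : K = ⊥ := by
      rcases IsSimpleOrder.eq_bot_or_eq_top K with h | h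
      · exact h
      · exfalso
        have : y ∈ K := by rw [h]; exact LieSubmodule.mem_top y
        exact hy_not ((LieSubmodule.mem_comap).mp this)
    rw [← LieModuleHom.ker_eq_bot, LieSubmodule.eq_bot_iff]
    intro s hs
    rw [LieModuleHom.mem_ker] at hs
    have hs' : (s : M × N).1 = 0 := hs
    have hmem : (s : M × N).2 ∈ K := by
      rw [LieSubmodule.mem_comap, inrHom_apply]
      have : ((0 : M), (s : M × N).2) = (s : M × N) := Prod.ext hs'.symm rfl
      rw [this]; exact s.2
    rw [hK] at hmem
    have h2 : (s : M × N).2 = 0 := (LieSubmodule.mem_bot _).mp hmem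
    exact Subtype.ext (Prod.ext hs' h2)
  -- surjectivity: the images are nonzero Lie submodules of irreducible modules
  have hsurj₂ : Function.Surjective f₂ := by
    rw [← LieModuleHom.range_eq_top]
    rcases IsSimpleOrder.eq_bot_or_eq_top f₂.range with h | h
    · exfalso
      have hy' : y ∈ f₂.range := (LieModuleHom.mem_range _ _).mpr ⟨⟨(x, y), hzS⟩, rfl⟩
      rw [h] at hy'
      exact hy0 ((LieSubmodule.mem_bot _).mp hy')
    · exact h
  have hsurj₁ : Function.Surjective f₁ := by
    rw [← LieModuleHom.range_eq_top]
    rcases IsSimpleOrder.eq_bot_or_eq_top f₁.range with h | h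
    · exfalso
      have hx' : x ∈ f₁.range := (LieModuleHom.mem_range _ _).mpr ⟨⟨(x, y), hzS⟩, rfl⟩
      rw [h] at hx'
      exact hx0 ((LieSubmodule.mem_bot _).mp hx')
    · exact h
  exact ⟨(equivOfBijective f₁ ⟨hinj₁, hsurj₁⟩).symm.trans (equivOfBijective f₂ ⟨hinj₂, hsurj₂⟩)⟩

end Uniqueness

/-! ## 4. The Fock pieces `F_k` are THE irreducible lowest weight `𝔤𝔩₃(ℂ)`-modules of their lowest weights -/

section FockPieces

open HodgeCM.PerL34.Fock

/-- `HarmVar = Fin 2 ⊕ Unit` is exhausted by `z₁, z₂, w` -/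
theorem harmVar_cases (i : HarmVar) : i = Sum.inl 0 ∨ i = Sum.inl 1 ∨ i = Sum.inr () := by
  rcases i with ⟨_ | _ | n, hn⟩ | ⟨⟩
  · exact Or.inl rfl
  · exact Or.inr (Or.inl rfl)
  · exact absurd hn (by omega)
  · exact Or.inr (Or.inr rfl)

/-- (Ported verbatim from the HodgeCMPerL package; no docstring in the source.) -/
theorem inl0_ne_inl1 : (Sum.inl 0 : HarmVar) ≠ Sum.inl 1 := by decide
/-- (Ported verbatim from the HodgeCMPerL package; no docstring in the source.) -/
theorem inl1_ne_inr : (Sum.inl 1 : HarmVar) ≠ Sum.inr () := Sum.inl_ne_inr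
/-- (Ported verbatim from the HodgeCMPerL package; no docstring in the source.) -/
theorem inl0_ne_inr : (Sum.inl 0 : HarmVar) ≠ Sum.inr () := Sum.inl_ne_inr

/-- the lowest weight `(1, k+1, 0)` of `F_k`, `k ≥ 0` -/
def zpowWt (k : ℕ) : HarmVar → ℂ
  | Sum.inl 0 => 1
  | Sum.inl 1 => (k : ℂ) + 1
  | Sum.inr () => 0

/-- the lowest weight `(1, 1, -m)` of `F_{-m}`, `m ≥ 0` -/
def wpowWt (m : ℕ) : HarmVar → ℂ
  | Sum.inl 0 => 1
  | Sum.inl 1 => 1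
  | Sum.inr () => -(m : ℂ)

/-- `z₂^k` as an element of the Lie module `F_k` -/
noncomputable def zpowVec (k : ℕ) : ↥(fockPiece (k : ℤ)) := ⟨hmon 0 k 0, zpow_mem_hpiece k⟩

/-- `w^m` as an element of the Lie module `F_{-m}` -/
noncomputable def wpowVec (m : ℕ) : ↥(fockPiece (-(m : ℤ))) := ⟨hmon 0 0 m, wpow_mem_hpiece m⟩

/-- (Ported verbatim from the HodgeCMPerL package; no docstring in the source.) -/
theorem zpowVec_ne_zero (k : ℕ) : zpowVec k ≠ 0 := fun h => hmon_ne_zero 0 k 0 (congrArg Subtype.val h)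

/-- (Ported verbatim from the HodgeCMPerL package; no docstring in the source.) -/
theorem wpowVec_ne_zero (m : ℕ) : wpowVec m ≠ 0 := fun h => hmon_ne_zero 0 0 m (congrArg Subtype.val h)

/-- (Ported verbatim from the HodgeCMPerL package; no docstring in the source.) -/
theorem coe_lie_fockPiece (k : ℤ) (i j : HarmVar) (v : ↥(fockPiece k)) :
    ((⁅E i j, v⁆ : ↥(fockPiece k)) : HarmModel) = osc i j (v : HarmModel) := by
  rw [LieSubmodule.coe_bracket, gl3_lie_apply, oscRep_single]

/-- `z₂^k ∈ F_k` is a lowest weight vector of weight `(1, k+1, 0)` (from `FockLowestWeight`) -/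
theorem isExtremalVec_zpowVec (k : ℕ) :
    IsExtremalVec (Sum.inl 0) (Sum.inl 1) (Sum.inr ()) (zpowWt k) (zpowVec k) where
  diag i := by
    apply Subtype.ext
    rw [coe_lie_fockPiece, LieSubmodule.coe_smul]
    rcases harmVar_cases i with rfl | rfl | rfl
    · rw [zpowVec, (osc_diag_zpow k).1, zpowWt, one_smul]
    · rw [zpowVec, (osc_diag_zpow k).2.1, zpowWt]
    · rw [zpowVec, (osc_diag_zpow k).2.2, zpowWt, zero_smul]
  kill_ba := Subtype.ext (by rw [coe_lie_fockPiece, zpowVec, (osc_lower_zpow k).1]; rfl)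
  kill_ca := Subtype.ext (by rw [coe_lie_fockPiece, zpowVec, (osc_lower_zpow k).2.1]; rfl)
  kill_cb := Subtype.ext (by rw [coe_lie_fockPiece, zpowVec, (osc_lower_zpow k).2.2]; rfl)

/-- `w^m ∈ F_{-m}` is a lowest weight vector of weight `(1, 1, -m)` -/
theorem isExtremalVec_wpowVec (m : ℕ) :
    IsExtremalVec (Sum.inl 0) (Sum.inl 1) (Sum.inr ()) (wpowWt m) (wpowVec m) where
  diag i := by
    apply Subtype.ext
    rw [coe_lie_fockPiece, LieSubmodule.coe_smul]
    rcases harmVar_cases i with rfl | rfl | rfl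
    · rw [wpowVec, (osc_diag_wpow m).1, wpowWt, one_smul]
    · rw [wpowVec, (osc_diag_wpow m).2.1, wpowWt, one_smul]
    · rw [wpowVec, (osc_diag_wpow m).2.2, wpowWt]
  kill_ba := Subtype.ext (by rw [coe_lie_fockPiece, wpowVec, (osc_lower_wpow m).1]; rfl)
  kill_ca := Subtype.ext (by rw [coe_lie_fockPiece, wpowVec, (osc_lower_wpow m).2.1]; rfl)
  kill_cb := Subtype.ext (by rw [coe_lie_fockPiece, wpowVec, (osc_lower_wpow m).2.2]; rfl)

variable {M : Type*} [AddCommGroup M] [Module ℂ M] [LieRingModule (Matrix HarmVar HarmVar ℂ) M]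
  [LieModule ℂ (Matrix HarmVar HarmVar ℂ) M]

/-- **External characterisation of `F_k`, `k ≥ 0`.**  Any irreducible `𝔤𝔩₃(ℂ)`-Lie module with a nonzero lowest
weight vector (killed by `E₂₁, E₃₁, E₃₂`) of weight `(1, k+1, 0)` is isomorphic to the Fock piece `F_k`. -/
theorem nonempty_equiv_fockPiece_of_lowestWeight_zpow [LieModule.IsIrreducible ℂ (Matrix HarmVar HarmVar ℂ) M]
    (k : ℕ) {x : M} (hx : IsExtremalVec (Sum.inl 0) (Sum.inl 1) (Sum.inr ()) (zpowWt k) x) (hx0 : x ≠ 0) :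
    Nonempty (M ≃ₗ⁅ℂ, Matrix HarmVar HarmVar ℂ⁆ ↥(fockPiece (k : ℤ))) := by
  haveI := fockPiece_isIrreducible (k : ℤ)
  exact nonempty_equiv_of_isExtremalVec inl0_ne_inl1 inl1_ne_inr inl0_ne_inr harmVar_cases hx
    (isExtremalVec_zpowVec k) hx0 (zpowVec_ne_zero k)

/-- **External characterisation of `F_{-m}`, `m ≥ 0`.**  Any irreducible `𝔤𝔩₃(ℂ)`-Lie module with a nonzero
lowest weight vector of weight `(1, 1, -m)` is isomorphic to the Fock piece `F_{-m}`. -/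
theorem nonempty_equiv_fockPiece_of_lowestWeight_wpow [LieModule.IsIrreducible ℂ (Matrix HarmVar HarmVar ℂ) M]
    (m : ℕ) {x : M} (hx : IsExtremalVec (Sum.inl 0) (Sum.inl 1) (Sum.inr ()) (wpowWt m) x) (hx0 : x ≠ 0) :
    Nonempty (M ≃ₗ⁅ℂ, Matrix HarmVar HarmVar ℂ⁆ ↥(fockPiece (-(m : ℤ)))) := by
  haveI := fockPiece_isIrreducible (-(m : ℤ))
  exact nonempty_equiv_of_isExtremalVec inl0_ne_inl1 inl1_ne_inr inl0_ne_inr harmVar_cases hx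
    (isExtremalVec_wpowVec m) hx0 (wpowVec_ne_zero m)

/-- conversely, of course, `F_k` and `F_{k'}` have different lowest weights for `k ≠ k'`; together with
`fockPiece_hom_eq_zero` the lowest weight line is a complete invariant of the pieces -/
theorem zpowWt_injective : Function.Injective zpowWt := by
  intro k k' h
  have := congrFun h (Sum.inl 1)
  simp only [zpowWt] at this
  exact_mod_cast add_right_cancel this

/-- (Ported verbatim from the HodgeCMPerL package; no docstring in the source.) -/
theorem wpowWt_injective : Function.Injective wpowWt := by
  intro m m' h
  have := congrFun h (Sum.inr ())
  simp only [wpowWt, neg_inj] at this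
  exact_mod_cast this

/-- (Ported verbatim from the HodgeCMPerL package; no docstring in the source.) -/
theorem zpowWt_ne_wpowWt (k m : ℕ) (h : zpowWt k = wpowWt m) : k = 0 ∧ m = 0 := by
  have h1 := congrFun h (Sum.inl 1)
  have h2 := congrFun h (Sum.inr ())
  simp only [zpowWt, wpowWt] at h1 h2
  constructor
  · exact_mod_cast (add_eq_right.mp h1 : (k : ℂ) = 0)
  · exact_mod_cast (neg_eq_zero.mp h2.symm : (m : ℂ) = 0)

end FockPieces

/-! ## 5. The mirror statement for the definite pair: `Sym^d ℂ³` is THE irreducible `𝔤𝔩₃(ℂ)`-module of highest weight `(d, 0, 0)`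

The same theorem with the index triple read in the opposite order `(2, 1, 0)` characterises HIGHEST weight
modules: `z₁^d ∈ Sym^d` is killed by the raising polarisations `z₁∂₂, z₁∂₃, z₂∂₃` and has weight `(d, 0, 0)`. -/

section SymPieces

open MvPolynomial

open HodgeCM.PerL34.Fock

/-- the highest weight `(d, 0, 0)` of `Sym^d ℂ³` -/
def symWt (d : ℕ) (i : Fin 3) : ℂ := if i = 0 then (d : ℂ) else 0

/-- (Ported verbatim from the HodgeCMPerL package; no docstring in the source.) -/
theorem X0pow_mem_dpiece (d : ℕ) : (X 0 : DefModel) ^ d ∈ dpiece d := by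
  rw [mem_dpiece_iff_isHomogeneous]
  simpa using (isHomogeneous_X ℂ (0 : Fin 3)).pow d

/-- `z₁^d` as an element of the Lie module `Sym^d` -/
noncomputable def symVec (d : ℕ) : ↥(symPiece d) := ⟨(X 0 : DefModel) ^ d, X0pow_mem_dpiece d⟩

/-- (Ported verbatim from the HodgeCMPerL package; no docstring in the source.) -/
theorem symVec_ne_zero (d : ℕ) : symVec d ≠ 0 := fun h =>
  pow_ne_zero d (X_ne_zero (0 : Fin 3)) (congrArg Subtype.val h : ((symVec d : ↥(symPiece d)) : DefModel) = 0)

/-- (Ported verbatim from the HodgeCMPerL package; no docstring in the source.) -/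
theorem coe_lie_symPiece (d : ℕ) (i j : Fin 3) (v : ↥(symPiece d)) :
    ((⁅E i j, v⁆ : ↥(symPiece d)) : DefModel) = X i * pderiv j (v : DefModel) := by
  rw [LieSubmodule.coe_bracket, gl3_lie_apply_def, dERep_single, dE_apply]

/-- (Ported verbatim from the HodgeCMPerL package; no docstring in the source.) -/
theorem X_mul_pderiv_X0pow_of_ne (i : Fin 3) {j : Fin 3} (hj : j ≠ 0) (d : ℕ) :
    (X i : DefModel) * pderiv j ((X 0 : DefModel) ^ d) = 0 := by
  rw [pderiv_pow, pderiv_X_of_ne (Ne.symm hj), mul_zero, mul_zero]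

/-- (Ported verbatim from the HodgeCMPerL package; no docstring in the source.) -/
theorem X_mul_pderiv_X0pow_diag (i : Fin 3) (d : ℕ) :
    (X i : DefModel) * pderiv i ((X 0 : DefModel) ^ d) = symWt d i • (X 0 : DefModel) ^ d := by
  by_cases h : i = 0
  · subst h
    rw [symWt, if_pos rfl, pderiv_pow, pderiv_X_self, mul_one, MvPolynomial.smul_eq_C_mul, map_natCast]
    cases d with
    | zero => simp
    | succ n => rw [Nat.add_sub_cancel, pow_succ]; ring
  · rw [symWt, if_neg h, zero_smul]
    exact X_mul_pderiv_X0pow_of_ne i h d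

/-- `z₁^d ∈ Sym^d` is a highest weight vector of weight `(d, 0, 0)`: extremal for the REVERSED triple `(2, 1, 0)` -/
theorem isExtremalVec_symVec (d : ℕ) : IsExtremalVec (2 : Fin 3) 1 0 (symWt d) (symVec d) where
  diag i := Subtype.ext (by rw [coe_lie_symPiece, LieSubmodule.coe_smul, symVec, X_mul_pderiv_X0pow_diag])
  kill_ba := Subtype.ext (by rw [coe_lie_symPiece, symVec, X_mul_pderiv_X0pow_of_ne 1 (by decide) d]; rfl)
  kill_ca := Subtype.ext (by rw [coe_lie_symPiece, symVec, X_mul_pderiv_X0pow_of_ne 0 (by decide) d]; rfl)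
  kill_cb := Subtype.ext (by rw [coe_lie_symPiece, symVec, X_mul_pderiv_X0pow_of_ne 0 (by decide) d]; rfl)

variable {M : Type*} [AddCommGroup M] [Module ℂ M] [LieRingModule (Matrix (Fin 3) (Fin 3) ℂ) M]
  [LieModule ℂ (Matrix (Fin 3) (Fin 3) ℂ) M]

/-- **External characterisation of `Sym^d ℂ³`.**  Any irreducible `𝔤𝔩₃(ℂ)`-Lie module with a nonzero highest weight
vector (killed by `E₁₂, E₁₃, E₂₃`) of weight `(d, 0, 0)` is isomorphic to `symPiece d = Sym^d ℂ³`. -/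
theorem nonempty_equiv_symPiece_of_highestWeight [LieModule.IsIrreducible ℂ (Matrix (Fin 3) (Fin 3) ℂ) M]
    (d : ℕ) {x : M} (hx : IsExtremalVec (2 : Fin 3) 1 0 (symWt d) x) (hx0 : x ≠ 0) :
    Nonempty (M ≃ₗ⁅ℂ, Matrix (Fin 3) (Fin 3) ℂ⁆ ↥(symPiece d)) := by
  haveI := symPiece_isIrreducible d
  exact nonempty_equiv_of_isExtremalVec (by decide) (by decide) (by decide) (by decide) hx
    (isExtremalVec_symVec d) hx0 (symVec_ne_zero d)

/-- (Ported verbatim from the HodgeCMPerL package; no docstring in the source.) -/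
theorem symWt_injective : Function.Injective symWt := by
  intro d d' h
  have : (d : ℂ) = d' := by simpa [symWt] using congrFun h 0
  exact_mod_cast this

end SymPieces

end Uniq

end Fock

end PerL34

end HodgeCM
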